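import Summits.QuantumFields.QCD.Theorems.PauliWegnerSeaChiralOneScaleTrajectoryJensenBridge

/-!
# Pointwise Jensen inequality for any number `N_f ≥ 2` of degenerate flavours (line `Sketch`, crux
`PauliWegnerSea.ChiralOneScaleTrajectory`, stmt-QuantumFields-17512; `N_f = 3` preparation)

`fm_rpow_le_secondMoment_const`: at a fully degenerate bare-mass tuple `(t,…,t)` with `N_f ≥ 2`, on any torus, at any
coupling, for any flavour `f` and sites `x, y`: `(E₊[X^s])^{2/s} ≤ 144 · E₊[Σ|G_f|²]` (`0 < s ≤ 2`), `E₊` the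
`|det|`-weighted quotient.  Same proof as the `N_f = 2` case (`fm_rpow_le_secondMoment_two`); the finiteness of the
second moment now comes from `|det D| · |G_f|² = |det D_t|^{N_f−2} |adj D_t|²`, bounded on the compact configuration
space for `N_f ≥ 2`.  Folklore.
-/

noncomputable section

namespace Summit.QuantumFields.QCD.Cruxes.ChiralOneScaleTrajectory.GoldstoneWitness

open scoped BigOperators
open MeasureTheory Filter
open Literature.MathematicalPhysics.QuantumFieldTheory Literature.MathematicalPhysics.QuantumLattice
  Literature.Probability.LatticeModels

variable {Nf L : ℕ} [NeZero L]

/-- **Degenerate flavours, `N_f ≥ 2`: the weighted squared propagator entry is bounded by a continuous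
function**: `|det D| · |D⁻¹((f,X),(f,Y))|² ≤ |Re det D_t|^{N_f−2} · |adj D_t(X,Y)|²` (equality off `{det D_t = 0}`). -/
theorem norm_det_mul_normSq_inv_le_const (hNf : 2 ≤ Nf) (U : GaugeConfig 4 L SU3) (t : ℝ) (f : Fin Nf)
    (X Y : TorusSite 4 L × Fin 3 × Fin 4) :
    ‖(diracMatrix U fun _ : Fin Nf => t).det‖ *
        ‖(diracMatrix U fun _ : Fin Nf => t)⁻¹ (quarkEquiv (f, X)) (quarkEquiv (f, Y))‖ ^ 2 ≤
      |(wilsonDirac (fundamentalRep (Fin 3)) U t 1).det.re| ^ (Nf - 2) *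
        ‖(wilsonDirac (fundamentalRep (Fin 3)) U t 1).adjugate X Y‖ ^ 2 := by
  have hNf0 : Nf ≠ 0 := by omega
  by_cases h : (wilsonDirac (fundamentalRep (Fin 3)) U t 1).det = 0
  · rw [det_diracMatrix_const, h, zero_pow hNf0, norm_zero, zero_mul]
    positivity
  · have hre := det_wilsonDirac_eq_ofReal_re U t
    have hd0 : (wilsonDirac (fundamentalRep (Fin 3)) U t 1).det.re ≠ 0 := fun h0 =>
      h (by rw [hre, h0, Complex.ofReal_zero])
    have hn : ‖(wilsonDirac (fundamentalRep (Fin 3)) U t 1).det‖ =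
        |(wilsonDirac (fundamentalRep (Fin 3)) U t 1).det.re| := by
      conv_lhs => rw [hre]
      rw [Complex.norm_real, Real.norm_eq_abs]
    have hnorm : ‖(diracMatrix U fun _ : Fin Nf => t).det‖ =
        |(wilsonDirac (fundamentalRep (Fin 3)) U t 1).det.re| ^ Nf := by
      rw [det_diracMatrix_const, norm_pow, hn]
    rw [norm_inv_diracMatrix_const_sq U t h f X Y, hnorm, ← mul_assoc]
    have hsplit : |(wilsonDirac (fundamentalRep (Fin 3)) U t 1).det.re| ^ Nf *
        (((wilsonDirac (fundamentalRep (Fin 3)) U t 1).det.re) ^ 2)⁻¹ =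
        |(wilsonDirac (fundamentalRep (Fin 3)) U t 1).det.re| ^ (Nf - 2) := by
      rw [← sq_abs, ← pow_sub₀ _ (abs_ne_zero.2 hd0) hNf]
    rw [hsplit]

/-- **Pointwise Jensen, `N_f ≥ 2` degenerate flavours**: `(E₊[X^s])^{2/s} ≤ 144 · E₊[Σ|G_f|²]`. -/
theorem fm_rpow_le_secondMoment_const :
    ∀ (Nf L : ℕ) [NeZero L], 2 ≤ Nf → ∀ (β t s : ℝ), 0 < s → s ≤ 2 → ∀ (f : Fin Nf) (x y : TorusSite 4 L), ((∫ U : GaugeConfig 4 L (Matrix.specialUnitaryGroup (Fin 3) ℂ), ‖(diracMatrix U fun _ : Fin Nf => t).det‖ * (∑ a : Fin 3, ∑ i : Fin 4, ∑ b : Fin 3, ∑ j : Fin 4, ‖(diracMatrix U fun _ : Fin Nf => t)⁻¹ (quarkEquiv (f, (x, a, i))) (quarkEquiv (f, (y, b, j)))‖) ^ s ∂(wilsonMeasure (fundamentalRep (Fin 3)) β)) / (∫ U : GaugeConfig 4 L (Matrix.specialUnitaryGroup (Fin 3) ℂ), ‖(diracMatrix U fun _ : Fin Nf => t).det‖ ∂(wilsonMeasure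 (fundamentalRep (Fin 3)) β))) ^ (2 / s) ≤ 144 * ((∫ U : GaugeConfig 4 L (Matrix.specialUnitaryGroup (Fin 3) ℂ), ‖(diracMatrix U fun _ : Fin Nf => t).det‖ * (∑ a : Fin 3, ∑ i : Fin 4, ∑ b : Fin 3, ∑ j : Fin 4, ‖(diracMatrix U fun _ : Fin Nf => t)⁻¹ (quarkEquiv (f, (x, a, i))) (quarkEquiv (f, (y, b, j)))‖ ^ (2 : ℕ)) ∂(wilsonMeasure (fundamentalRep (Fin 3)) β)) / (∫ U : GaugeConfig 4 L (Matrix.specialUnitaryGroup (Fin 3) ℂ), ‖(diracMatrix U fun _ : Fin Nf => t).det‖ ∂(wilsonMeasure (fundamentalRep (Fin 3)) β))) := by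
  intro Nf L _ hNf β t s hs hs2 f x y
  set mq : Fin Nf → ℝ := fun _ => t with hmq
  set μ := wilsonMeasure (d := 4) (L := L) (fundamentalRep (Fin 3)) β with hμ
  haveI : IsProbabilityMeasure μ := isProbabilityMeasure_wilsonMeasure _ (continuous_fundamentalRep _) _
  set P : Fin 3 → Fin 4 → FermiIdx Nf L := fun a i => quarkEquiv (f, (x, a, i)) with hP
  set Q : Fin 3 → Fin 4 → FermiIdx Nf L := fun b j => quarkEquiv (f, (y, b, j)) with hQ
  set G : GaugeConfig 4 L SU3 → Fin 3 → Fin 4 → Fin 3 → Fin 4 → ℝ :=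
    fun U a i b j => ‖(diracMatrix U mq)⁻¹ (P a i) (Q b j)‖ with hG
  set Y : GaugeConfig 4 L SU3 → ℝ := fun U =>
    ∑ a : Fin 3, ∑ i : Fin 4, ∑ b : Fin 3, ∑ j : Fin 4, G U a i b j with hY
  set Y2 : GaugeConfig 4 L SU3 → ℝ := fun U =>
    ∑ a : Fin 3, ∑ i : Fin 4, ∑ b : Fin 3, ∑ j : Fin 4, G U a i b j ^ 2 with hY2
  have hG0 : ∀ U a i b j, 0 ≤ G U a i b j := fun U a i b j => norm_nonneg _
  have hY0 : ∀ U, 0 ≤ Y U := fun U => Finset.sum_nonneg fun a _ => Finset.sum_nonneg fun i _ =>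
    Finset.sum_nonneg fun b _ => Finset.sum_nonneg fun j _ => hG0 U a i b j
  have hY20 : ∀ U, 0 ≤ Y2 U := fun U => Finset.sum_nonneg fun a _ => Finset.sum_nonneg fun i _ =>
    Finset.sum_nonneg fun b _ => Finset.sum_nonneg fun j _ => sq_nonneg _
  have hGm : ∀ a i b j, Measurable fun U => G U a i b j := fun a i b j =>
    (measurable_inv_diracMatrix_apply mq (P a i) (Q b j)).norm
  have hYm : Measurable Y := Finset.measurable_sum _ fun a _ => Finset.measurable_sum _ fun i _ =>
    Finset.measurable_sum _ fun b _ => Finset.measurable_sum _ fun j _ => hGm a i b j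
  have hY2m : Measurable Y2 := Finset.measurable_sum _ fun a _ => Finset.measurable_sum _ fun i _ =>
    Finset.measurable_sum _ fun b _ => Finset.measurable_sum _ fun j _ => (hGm a i b j).pow_const 2
  -- the uniform weight bound `|det D| · G² ≤ B` from the continuous majorant `|Re det D_t|^{N_f-2} Σ|adj|²`
  have hc : Continuous fun U : GaugeConfig 4 L SU3 => wilsonDirac (fundamentalRep (Fin 3)) U t 1 :=
    continuous_wilsonDirac _ (continuous_fundamentalRep (Fin 3)) t 1
  obtain ⟨B, hB⟩ : ∃ B : ℝ, ∀ (U : GaugeConfig 4 L SU3) a i b j,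
      ‖(diracMatrix U mq).det‖ * G U a i b j ^ 2 ≤ B := by
    have hcont : Continuous fun U : GaugeConfig 4 L SU3 =>
        |(wilsonDirac (fundamentalRep (Fin 3)) U t 1).det.re| ^ (Nf - 2) *
        ∑ a : Fin 3, ∑ i : Fin 4, ∑ b : Fin 3, ∑ j : Fin 4,
          ‖(wilsonDirac (fundamentalRep (Fin 3)) U t 1).adjugate (x, a, i) (y, b, j)‖ ^ 2 := by
      refine (((Complex.continuous_re.comp hc.matrix_det).abs).pow _).mul ?_
      refine continuous_finsetSum _ fun a _ => continuous_finsetSum _ fun i _ =>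
        continuous_finsetSum _ fun b _ => continuous_finsetSum _ fun j _ => ?_
      exact ((hc.matrix_adjugate.matrix_elem _ _).norm).pow 2
    obtain ⟨U₀, -, hU₀⟩ := (isCompact_univ (X := GaugeConfig 4 L SU3)).exists_isMaxOn
      Set.univ_nonempty hcont.continuousOn
    refine ⟨|(wilsonDirac (fundamentalRep (Fin 3)) U₀ t 1).det.re| ^ (Nf - 2) *
        ∑ a : Fin 3, ∑ i : Fin 4, ∑ b : Fin 3, ∑ j : Fin 4,
          ‖(wilsonDirac (fundamentalRep (Fin 3)) U₀ t 1).adjugate (x, a, i) (y, b, j)‖ ^ 2, fun U a i b j => ?_⟩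
    refine (norm_det_mul_normSq_inv_le_const hNf U t f _ _).trans ((?_ : _ ≤ _).trans (hU₀ (Set.mem_univ U)))
    have hw : 0 ≤ |(wilsonDirac (fundamentalRep (Fin 3)) U t 1).det.re| ^ (Nf - 2) := by positivity
    refine mul_le_mul_of_nonneg_left ?_ hw
    have h1 : ∀ a' i' b' j', 0 ≤ ‖(wilsonDirac (fundamentalRep (Fin 3)) U t 1).adjugate
        (x, a', i') (y, b', j')‖ ^ 2 := fun _ _ _ _ => sq_nonneg _
    calc ‖(wilsonDirac (fundamentalRep (Fin 3)) U t 1).adjugate (x, a, i) (y, b, j)‖ ^ 2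
        ≤ ∑ j' : Fin 4, ‖(wilsonDirac (fundamentalRep (Fin 3)) U t 1).adjugate (x, a, i) (y, b, j')‖ ^ 2 :=
          Finset.single_le_sum (fun j' _ => h1 a i b j') (Finset.mem_univ j)
      _ ≤ ∑ b' : Fin 3, ∑ j' : Fin 4, ‖(wilsonDirac (fundamentalRep (Fin 3)) U t 1).adjugate
            (x, a, i) (y, b', j')‖ ^ 2 :=
          Finset.single_le_sum (fun b' _ => Finset.sum_nonneg fun j' _ => h1 a i b' j') (Finset.mem_univ b)
      _ ≤ ∑ i' : Fin 4, ∑ b' : Fin 3, ∑ j' : Fin 4, ‖(wilsonDirac (fundamentalRep (Fin 3)) U t 1).adjugate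
            (x, a, i') (y, b', j')‖ ^ 2 :=
          Finset.single_le_sum (fun i' _ => Finset.sum_nonneg fun b' _ => Finset.sum_nonneg fun j' _ =>
            h1 a i' b' j') (Finset.mem_univ i)
      _ ≤ ∑ a' : Fin 3, ∑ i' : Fin 4, ∑ b' : Fin 3, ∑ j' : Fin 4,
            ‖(wilsonDirac (fundamentalRep (Fin 3)) U t 1).adjugate (x, a', i') (y, b', j')‖ ^ 2 :=
          Finset.single_le_sum (fun a' _ => Finset.sum_nonneg fun i' _ => Finset.sum_nonneg fun b' _ =>
            Finset.sum_nonneg fun j' _ => h1 a' i' b' j') (Finset.mem_univ a)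
  -- the rest is the `N_f = 2` argument verbatim
  have hwY2 : ∀ U, ‖(diracMatrix U mq).det‖ * Y2 U ≤ 144 * B := by
    intro U
    have : ‖(diracMatrix U mq).det‖ * Y2 U =
        ∑ a : Fin 3, ∑ i : Fin 4, ∑ b : Fin 3, ∑ j : Fin 4, ‖(diracMatrix U mq).det‖ * G U a i b j ^ 2 := by
      simp only [hY2, Finset.mul_sum]
    rw [this]
    calc ∑ a : Fin 3, ∑ i : Fin 4, ∑ b : Fin 3, ∑ j : Fin 4, ‖(diracMatrix U mq).det‖ * G U a i b j ^ 2
        ≤ ∑ _a : Fin 3, ∑ _i : Fin 4, ∑ _b : Fin 3, ∑ _j : Fin 4, B :=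
          Finset.sum_le_sum fun a _ => Finset.sum_le_sum fun i _ => Finset.sum_le_sum fun b _ =>
            Finset.sum_le_sum fun j _ => hB U a i b j
      _ = 144 * B := by simp; ring
  have hYsq : ∀ U, Y U ^ 2 ≤ 144 * Y2 U := fun U => sq_sum_four_le (G U)
  have hwYsq : ∀ U, ‖(diracMatrix U mq).det‖ * Y U ^ 2 ≤ 144 * (144 * B) := fun U =>
    calc ‖(diracMatrix U mq).det‖ * Y U ^ 2 ≤ ‖(diracMatrix U mq).det‖ * (144 * Y2 U) :=
          mul_le_mul_of_nonneg_left (hYsq U) (norm_nonneg _)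
      _ = 144 * (‖(diracMatrix U mq).det‖ * Y2 U) := by ring
      _ ≤ 144 * (144 * B) := by nlinarith [hwY2 U]
  obtain ⟨Bd, hBd⟩ := exists_norm_det_diracMatrix_le (S := L) mq
  have hwYs : ∀ U, ‖(diracMatrix U mq).det‖ * Y U ^ s ≤ Bd + 144 * (144 * B) := fun U =>
    calc ‖(diracMatrix U mq).det‖ * Y U ^ s ≤ ‖(diracMatrix U mq).det‖ * (1 + Y U ^ 2) :=
          mul_le_mul_of_nonneg_left (rpow_le_one_add_sq (hY0 U) hs hs2) (norm_nonneg _)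
      _ = ‖(diracMatrix U mq).det‖ + ‖(diracMatrix U mq).det‖ * Y U ^ 2 := by ring
      _ ≤ Bd + 144 * (144 * B) := add_le_add (hBd U) (hwYsq U)
  have hiYs : Integrable (fun U => Y U ^ s) (qcdLatticeMeasure L β mq) :=
    integrable_qcdLatticeMeasure_of_weight_bound β mq _ (hYm.pow_const s) _ fun U => by
      rw [Real.norm_eq_abs, abs_of_nonneg (Real.rpow_nonneg (hY0 U) s)]; exact hwYs U
  have hiY2r : Integrable (fun U => Y U ^ (2 : ℝ)) (qcdLatticeMeasure L β mq) := by
    simp_rw [Real.rpow_two]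
    exact integrable_qcdLatticeMeasure_of_weight_bound β mq _ (hYm.pow_const 2) _ fun U => by
      rw [Real.norm_eq_abs, abs_of_nonneg (sq_nonneg _)]; exact hwYsq U
  have hdm := measurable_norm_det_diracMatrix (S := L) mq
  have hiwYsq : Integrable (fun U => ‖(diracMatrix U mq).det‖ * Y U ^ (2 : ℝ)) μ := by
    simp_rw [Real.rpow_two]
    refine Integrable.of_bound (hdm.mul (hYm.pow_const 2)).aestronglyMeasurable (144 * (144 * B))
      (Eventually.of_forall fun U => ?_)
    rw [Real.norm_eq_abs, abs_of_nonneg (mul_nonneg (norm_nonneg _) (sq_nonneg _))]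
    exact hwYsq U
  have hiwY2 : Integrable (fun U => ‖(diracMatrix U mq).det‖ * (144 * Y2 U)) μ := by
    refine Integrable.of_bound (hdm.mul (hY2m.const_mul 144)).aestronglyMeasurable (144 * (144 * B))
      (Eventually.of_forall fun U => ?_)
    rw [Real.norm_eq_abs, abs_of_nonneg (mul_nonneg (norm_nonneg _) (by nlinarith [hY20 U]))]
    calc ‖(diracMatrix U mq).det‖ * (144 * Y2 U) = 144 * (‖(diracMatrix U mq).det‖ * Y2 U) := by ring
      _ ≤ 144 * (144 * B) := by nlinarith [hwY2 U]
  have hZ := integral_norm_det_diracMatrix_pos_all (S := L) β mq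
  have hJ : qcdPhaseQuenchedExpect β L mq (fun U => Y U ^ s) ≤
      (qcdPhaseQuenchedExpect β L mq (fun U => Y U ^ (2 : ℝ))) ^ (s / 2) :=
    qcdPhaseQuenchedExpect_rpow_le_rpow β mq hZ Y hY0 hs hs2 hiYs hiY2r
  have hCS : qcdPhaseQuenchedExpect β L mq (fun U => Y U ^ (2 : ℝ)) ≤
      qcdPhaseQuenchedExpect β L mq (fun U => 144 * Y2 U) :=
    qcdPhaseQuenchedExpect_mono β mq _ _ hiwYsq hiwY2 (Eventually.of_forall fun U => by
      rw [Real.rpow_two]; exact hYsq U)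
  have hlin : qcdPhaseQuenchedExpect β L mq (fun U => 144 * Y2 U) = 144 * qcdPhaseQuenchedExpect β L mq Y2 := by
    have := qcdPhaseQuenchedExpect_smul β mq (144 : ℝ) Y2
    simp only [smul_eq_mul] at this
    exact this
  have hq2 : 0 ≤ qcdPhaseQuenchedExpect β L mq (fun U => Y U ^ (2 : ℝ)) := by
    rw [qcdPhaseQuenchedExpect_eq_div]
    exact div_nonneg (integral_nonneg fun U => mul_nonneg (norm_nonneg _) (Real.rpow_nonneg (hY0 U) _))
      (integral_nonneg fun U => norm_nonneg _)
  have hqs : 0 ≤ qcdPhaseQuenchedExpect β L mq (fun U => Y U ^ s) := by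
    rw [qcdPhaseQuenchedExpect_eq_div]
    exact div_nonneg (integral_nonneg fun U => mul_nonneg (norm_nonneg _) (Real.rpow_nonneg (hY0 U) _))
      (integral_nonneg fun U => norm_nonneg _)
  have hFM : (∫ U, ‖(diracMatrix U mq).det‖ * Y U ^ s ∂μ) / (∫ U, ‖(diracMatrix U mq).det‖ ∂μ) =
      qcdPhaseQuenchedExpect β L mq (fun U => Y U ^ s) :=
    (qcdPhaseQuenchedExpect_eq_div β mq _).symm
  have hQ2 : (∫ U, ‖(diracMatrix U mq).det‖ * Y2 U ∂μ) / (∫ U, ‖(diracMatrix U mq).det‖ ∂μ) =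
      qcdPhaseQuenchedExpect β L mq Y2 :=
    (qcdPhaseQuenchedExpect_eq_div β mq _).symm
  change ((∫ U, ‖(diracMatrix U mq).det‖ * Y U ^ s ∂μ) / (∫ U, ‖(diracMatrix U mq).det‖ ∂μ)) ^ (2 / s) ≤
    144 * ((∫ U, ‖(diracMatrix U mq).det‖ * Y2 U ∂μ) / (∫ U, ‖(diracMatrix U mq).det‖ ∂μ))
  rw [hFM, hQ2]
  have h2s : 0 < 2 / s := by positivity
  calc (qcdPhaseQuenchedExpect β L mq (fun U => Y U ^ s)) ^ (2 / s)
      ≤ ((qcdPhaseQuenchedExpect β L mq (fun U => Y U ^ (2 : ℝ))) ^ (s / 2)) ^ (2 / s) :=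
        Real.rpow_le_rpow hqs hJ h2s.le
    _ = qcdPhaseQuenchedExpect β L mq (fun U => Y U ^ (2 : ℝ)) := by
        rw [← Real.rpow_mul hq2, show s / 2 * (2 / s) = 1 by field_simp, Real.rpow_one]
    _ ≤ 144 * qcdPhaseQuenchedExpect β L mq Y2 := hCS.trans_eq hlin

end Summit.QuantumFields.QCD.Cruxes.ChiralOneScaleTrajectory.GoldstoneWitness

end
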